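import Literature.AlgebraicGeometry.Motives.AbelianVarietyTorsionFiniteProofs
import Literature.AlgebraicGeometry.Modules.CechClassClassPullback
import Literature.AlgebraicGeometry.Modules.DetClassOfIso
import Literature.AlgebraicGeometry.Modules.PullbackFrame
import Literature.AlgebraicGeometry.Modules.LineBundleOfCocycleClass
import Literature.AlgebraicGeometry.Motives.ProjectiveSpaceSections
import HarnessLib

/-!
# The pull-back of an ample `𝒪_X(D)` along an affine morphism is `𝒪_Y(Θ)` with `Θ` ample; the hyperplane divisor of a
# closed immersion into `ℙ^d_K`

Layer `Literature/AlgebraicGeometry/Motives`, namespace `Literature.AlgebraicGeometry.Motives.CartierDivisor`.  THEOREMS ONLY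
(no definition, no named fact, no instance, no notation, no `sorry`).  Cell `hodgecm-mathlib` (D-0151), F-DAG F-6 CAPSTONE brick
S1b (census `B-provers/B-p18/g19/CENSUS-F6-Capstone-MFKSubfunctorOfHilb.B-p18g19.md` §0 F4; cut to B-p18 (g19) by the bytes author
B-p02 (g14) 08:50:00Z, owner confirmed B-plan1 (g16) 08:53:12Z): the (V) polarization closer ★
`AbelianSchemeOver.exists_polarization_lam_eq_of_LDelta_cube` consumes, at every geometric fibre `A_s` of the family, the binder
`hamp : ∃ Θ, Θ.IsAmple ∧ Nonempty (pr_s^*L ≅ A.lineBundleOfDivisor s Θ)` (`lineBundleOfDivisor s Θ = Modules.lineBundle Θ.toUnitCocycle`);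
at the Hilbert-scheme instantiation `L = 𝒪(1)|_Z` is the pull-back of the hyperplane bundle along a CLOSED IMMERSION of the fibre
into projective space, and this file provides that binder in the module currency.  Count-neutral capital: HC_CM is proved only
modulo the 7 printed citations until rung 0 closes — nothing here bears on a summit statement.

Everything is assembled from ★ bricks: the class pull-back `D.classPullback g` of a Cartier divisor along an ARBITRARY morphism
of integral schemes (★ `Motives/CartierDivisorClassPullback`), its ampleness for `g` affine and `D` ample (★
`CartierDivisor.IsAmple.classPullback`, [GortzWedhorn2020] Prop. 13.66 (2): «as `f` is affine, `f^*𝓜` is ample if `𝓜` is ample»),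
the identity `g^*[𝒪_X(D)] = [𝒪_Y(g^*D)]` in `Ȟ¹(Y, 𝒪_Y^×)` (★ `CartierDivisor.pullback_cechClass_eq_cechClass_classPullback`,
[GortzWedhorn2020] (11.16)), `[det f^*E] = f^*[det E]` (★ `Modules.detClass_pullback`), `[𝒪(D)] = [D]` (★ `UnitCocycle.detClass_lineBundle`)
and «rank-one modules with the same class are isomorphic» (★ `Modules.nonempty_iso_iff_detClass_eq`, [Hartshorne1977] III Ex. 4.5).

* §1 `detClass_pullback_lineBundle_toUnitCocycle` — `[g^*𝒪_X(D)] = [𝒪_Y(g^*D)]`;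
  **`nonempty_pullback_lineBundle_iso_lineBundle_classPullback`** — `g^*𝒪_X(D) ≅ 𝒪_Y(g^*D)` as `𝒪_Y`-MODULES, for any morphism
  `g` of integral schemes ([GortzWedhorn2020] (11.16) «`g^*𝒪_X(D) ≅ 𝒪_Y(g^*D)`»); `nonempty_pullback_iso_lineBundle_classPullback` —
  the same for any rank-one `E ≅ 𝒪_X(D)`.
* §2 **`exists_isAmple_nonempty_pullback_lineBundle_iso`** — for `g` AFFINE (e.g. a closed immersion) and `D` ample:
  `∃ Θ, Θ.IsAmple ∧ g^*𝒪_X(D) ≅ 𝒪_Y(Θ)`; `exists_isAmple_nonempty_pullback_iso` — for any rank-one `E ≅ 𝒪_X(D)` with `D` ample.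
* §3 **`exists_isAmple_nonempty_pullback_hyperplane_iso`** — for `ι : Y → ℙ^d_K` affine (a closed immersion, say) the pull-back of
  the hyperplane bundle `𝒪_{ℙ^d}(H)` is `𝒪_Y(Θ)` with `Θ` ample (★ `ProjSpace.isAmple_hyperplane`): «`𝒪(1)` restricted to a closed
  subvariety of `ℙ^d` is an ample `𝒪(Θ)`» — the `hamp` binder of MFK Prop. 7.3 step (V) at a geometric fibre.

## References
* U. Görtz, T. Wedhorn, *Algebraic Geometry I: Schemes*, 2nd ed. (2020): Prop. 13.66 (2) (p. 509) (`f` affine, `𝓜` ample ⇒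
  `f^*𝓜` ample), (11.16) Def. 11.49 / Prop. 11.50 (p. 392) (`g^*𝒪_X(D) ≅ 𝒪_Y(g^*D)`), Prop. 11.21 (p. 374), Example 13.45.
  [GortzWedhorn2020]
* R. Hartshorne, *Algebraic Geometry* (1977): II Ex. 6.8 (`f^*` on `Pic`), III Ex. 4.5 (`Pic X ≅ Ȟ¹(X, 𝒪_X^×)`), II Prop. 7.2 /
  Ex. 5.13 (`𝒪(1)` on a closed subscheme of `ℙⁿ`). [Hartshorne1977]
* D. Mumford, J. Fogarty, F. Kirwan, *Geometric Invariant Theory*, 3rd ed. (1994), Ch. 7 §2 Prop. 7.3, proof, step (V) (p. 134)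
  (`L₄ = 𝒪_Z ⊗ p₁^*𝒪_{ℙ_m}(1)`). [MumfordFogartyKirwan1994]
-/

noncomputable section

universe u

open CategoryTheory AlgebraicGeometry Opposite TopologicalSpace

namespace Literature.AlgebraicGeometry.Motives

namespace CartierDivisor

open Literature.AlgebraicGeometry.Modules

variable {X Y : Scheme.{u}} [IsIntegral X] [IsIntegral Y] (g : Y ⟶ X)

/-! ## §1 `g^*𝒪_X(D) ≅ 𝒪_Y(g^*D)` as modules -/

/-- **`[g^*𝒪_X(D)] = [𝒪_Y(g^*D)]` in `Ȟ¹(Y, 𝒪_Y^×)`** (determinant class of the pulled-back line bundle = class of the class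
pull-back): ★ `detClass_pullback` + ★ `UnitCocycle.detClass_lineBundle` + ★ `pullback_cechClass_eq_cechClass_classPullback`.
[cite: GortzWedhorn2020, Def. 11.49 and Prop. 11.50 (p. 392)] [cite: Hartshorne1977, II Ex. 6.8] -/
theorem detClass_pullback_lineBundle_toUnitCocycle (D : CartierDivisor X) :
    detClass ((UnitCocycle.isFiniteLocallyFree_lineBundle D.toUnitCocycle).pullback g) =
      (D.classPullback g).cechClass := by
  rw [detClass_pullback (hE := UnitCocycle.isFiniteLocallyFree_lineBundle D.toUnitCocycle),
    UnitCocycle.detClass_lineBundle, ← cechClass_eq_mk, pullback_cechClass_eq_cechClass_classPullback]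

/-- **`g^*𝒪_X(D) ≅ 𝒪_Y(g^*D)` as `𝒪_Y`-modules**, for ANY morphism `g : Y → X` of integral schemes and the class pull-back
`g^*D = D.classPullback g` ([GortzWedhorn2020] (11.16): «`g^*𝒪_X(D) ≅ 𝒪_Y(g^*D)`»; rank-one modules with equal classes are
isomorphic, ★ `nonempty_iso_iff_detClass_eq`). [cite: GortzWedhorn2020, Def. 11.49 and Prop. 11.50 (p. 392)]
[cite: Hartshorne1977, III Ex. 4.5] -/
theorem nonempty_pullback_lineBundle_iso_lineBundle_classPullback (D : CartierDivisor X) :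
    Nonempty ((Scheme.Modules.pullback g).obj (lineBundle D.toUnitCocycle) ≅
      lineBundle (D.classPullback g).toUnitCocycle) := by
  refine (nonempty_iso_iff_detClass_eq (hasRank_pullback g (UnitCocycle.hasRank_lineBundle _))
    (UnitCocycle.hasRank_lineBundle _) ((UnitCocycle.isFiniteLocallyFree_lineBundle D.toUnitCocycle).pullback g)
    (UnitCocycle.isFiniteLocallyFree_lineBundle _)).2 ?_
  rw [detClass_pullback_lineBundle_toUnitCocycle, UnitCocycle.detClass_lineBundle, cechClass_eq_mk]

/-- **A rank-one module `E ≅ 𝒪_X(D)` pulls back to `𝒪_Y(g^*D)`** along any morphism of integral schemes.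
[cite: GortzWedhorn2020, Def. 11.49 and Prop. 11.50 (p. 392)] -/
theorem nonempty_pullback_iso_lineBundle_classPullback {E : X.Modules} (D : CartierDivisor X)
    (φ : E ≅ lineBundle D.toUnitCocycle) :
    Nonempty ((Scheme.Modules.pullback g).obj E ≅ lineBundle (D.classPullback g).toUnitCocycle) := by
  obtain ⟨e⟩ := nonempty_pullback_lineBundle_iso_lineBundle_classPullback g D
  exact ⟨(Scheme.Modules.pullback g).mapIso φ ≪≫ e⟩

/-! ## §2 Affine `g`, ample `D`: the pull-back is an ample `𝒪_Y(Θ)` -/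

/-- **The pull-back of an ample `𝒪_X(D)` along an AFFINE morphism of integral schemes is `𝒪_Y(Θ)` with `Θ` AMPLE**
([GortzWedhorn2020] Prop. 13.66 (2): «As `f` is affine, `f^*𝓜` is ample if `𝓜` is ample»; `Θ = g^*D` the class pull-back,
★ `IsAmple.classPullback`) — in particular along a closed immersion. [cite: GortzWedhorn2020, Prop. 13.66 (2) (p. 509)]
[cite: GortzWedhorn2020, Def. 11.49 and Prop. 11.50 (p. 392)] -/
theorem exists_isAmple_nonempty_pullback_lineBundle_iso [IsAffineHom g] (D : CartierDivisor X) (hD : D.IsAmple) :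
    ∃ Θ : CartierDivisor Y, Θ.IsAmple ∧
      Nonempty ((Scheme.Modules.pullback g).obj (lineBundle D.toUnitCocycle) ≅ lineBundle Θ.toUnitCocycle) :=
  ⟨D.classPullback g, hD.classPullback g, nonempty_pullback_lineBundle_iso_lineBundle_classPullback g D⟩

/-- **A rank-one module isomorphic to an ample `𝒪_X(D)` pulls back along an affine morphism to an ample `𝒪_Y(Θ)`.**
[cite: GortzWedhorn2020, Prop. 13.66 (2) (p. 509)] -/
theorem exists_isAmple_nonempty_pullback_iso [IsAffineHom g] {E : X.Modules} (D : CartierDivisor X)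
    (φ : E ≅ lineBundle D.toUnitCocycle) (hD : D.IsAmple) :
    ∃ Θ : CartierDivisor Y, Θ.IsAmple ∧
      Nonempty ((Scheme.Modules.pullback g).obj E ≅ lineBundle Θ.toUnitCocycle) :=
  ⟨D.classPullback g, hD.classPullback g, nonempty_pullback_iso_lineBundle_classPullback g D φ⟩

/-- The same with the witness exposed: `Θ = D.classPullback g`. [cite: GortzWedhorn2020, Prop. 13.66 (2) (p. 509)] -/
theorem isAmple_classPullback_and_nonempty_pullback_iso [IsAffineHom g] {E : X.Modules} (D : CartierDivisor X)
    (φ : E ≅ lineBundle D.toUnitCocycle) (hD : D.IsAmple) :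
    (D.classPullback g).IsAmple ∧
      Nonempty ((Scheme.Modules.pullback g).obj E ≅ lineBundle (D.classPullback g).toUnitCocycle) :=
  ⟨hD.classPullback g, nonempty_pullback_iso_lineBundle_classPullback g D φ⟩

/-! ## §3 The hyperplane divisor of an affine morphism (closed immersion) to `ℙ^d_K` -/

/-- **«`𝒪(1)` RESTRICTED TO A CLOSED SUBVARIETY OF `ℙ^d` IS AN AMPLE `𝒪(Θ)`»**: for a field `K`, an integral scheme `Y` and an
AFFINE morphism `ι : Y → ℙ^d_K` (e.g. a closed immersion), the pull-back of the hyperplane bundle `𝒪_{ℙ^d}(H)`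
(★ `ProjSpace.hyperplane`, ample by ★ `ProjSpace.isAmple_hyperplane`) is `𝒪_Y(Θ)` for an AMPLE Cartier divisor `Θ` on `Y`
— the `hamp` binder of [MumfordFogartyKirwan1994] Prop. 7.3 step (V) at a geometric fibre of an embedded family
`Z ⊂ ℙ^m × S` (`L = 𝒪_Z ⊗ p₁^*𝒪(1)`). [cite: GortzWedhorn2020, Prop. 13.66 (2) (p. 509) and Example 13.45]
[cite: MumfordFogartyKirwan1994, Ch. 7 §2 Prop. 7.3, proof, step (V) (p. 134)] -/
theorem exists_isAmple_nonempty_pullback_hyperplane_iso {d : ℕ} {K : Type u} [Field K] (ι : Y ⟶ ProjSpace.P d K)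
    [IsAffineHom ι] :
    ∃ Θ : CartierDivisor Y, Θ.IsAmple ∧
      Nonempty ((Scheme.Modules.pullback ι).obj (lineBundle (ProjSpace.hyperplane d K).toUnitCocycle) ≅
        lineBundle Θ.toUnitCocycle) :=
  exists_isAmple_nonempty_pullback_lineBundle_iso ι _ ProjSpace.isAmple_hyperplane

/-- Module form of §3: any rank-one `E` on `ℙ^d_K` isomorphic to the hyperplane bundle pulls back along an affine `ι : Y → ℙ^d_K`
to an ample `𝒪_Y(Θ)`. [cite: GortzWedhorn2020, Prop. 13.66 (2) (p. 509) and Example 13.45] -/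
theorem exists_isAmple_nonempty_pullback_iso_of_iso_hyperplane {d : ℕ} {K : Type u} [Field K]
    (ι : Y ⟶ ProjSpace.P d K) [IsAffineHom ι] {E : (ProjSpace.P d K).Modules}
    (φ : E ≅ lineBundle (ProjSpace.hyperplane d K).toUnitCocycle) :
    ∃ Θ : CartierDivisor Y, Θ.IsAmple ∧
      Nonempty ((Scheme.Modules.pullback ι).obj E ≅ lineBundle Θ.toUnitCocycle) :=
  exists_isAmple_nonempty_pullback_iso ι _ φ ProjSpace.isAmple_hyperplane

end CartierDivisor

end Literature.AlgebraicGeometry.Motives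

end
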